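import Literature.AlgebraicGeometry.AbelianSchemes.FrobeniusCoverRecognition                    -- file I (LA3-p02): recognition + downstairs cover
import HarnessLib

/-!
# The Frobenius cover of the special fibre from the generic Serre cover: `c̄′ : 𝒜_{x̄′} → (𝒜_{x̄})^{(q)}` with the Serre presentation of `𝔞`, kernel `𝒜_{x̄′}[𝔞]`,
# `c̄′^*λ^{(q)} = n·λ`, `ι`-equivariance and `c̄′(σ^a(x̄′)) = F(σ^a(x̄))` ([Shimura1998] §13.1 Thm. 1, §18.6; [SerreTate1968] §1; [MumfordAV1970] §7, §15, §23)

Topic `AlgebraicGeometry/AbelianSchemes`, namespace `Literature.AlgebraicGeometry.AbelianSchemes.AbelianSchemeOver`.  THEOREMS ONLY (no definition, no named fact,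
no `instance`, no notation, no `sorry`).  Cell `hodgecm-mathlib` (D-0151), F0∕P6 «MOD», «GO 500» line L3 (socket `stub_FROB` of the D-line
`Cruxes/HLiu418/Lines/F0_P6a_DatumOfInputs.lean`), COVER ROAD A → `stub_TWISTCOVER0`'s cover conjunct (closer skeleton v4, A-p03 (g30) 06386a30; cover assembly
statement `StubFROBCover.skeleton.v1` 418098d2, head `frobCover₀_of_coverΩ` ∕ `…_of_coverKerΩ`).  This file is the GENERIC (tuple-parametric) form of that head: from the
UPSTAIRS Serre cover between the fibres of ONE family `𝒜 → 𝓨` at two `Ω̄`-points `x, x″` of the generic fibre, with its kernel law (spine ED. 4 `CoverKerΩ`, K-law),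
polarisation law with scalar `n`, `ι`-equivariance and level transport, it PRODUCES a cover of the Frobenius twist `(𝒜_{x̄})^{(q)}` by `𝒜_{x̄′}` (`x̄′ = red x`, `x̄` ANY special
point with `red x″ = x̄ ≫ F̃` — ★ `GaloisThickeningMovedSheetFrobenius` supplies it for `x = ℓ_e(σ•y)`, `x″ = ℓ_{e∘γ}(σ•y)`, `x̄ = red₀ y`) carrying the five clauses of the P6a
letter `FrobCover₀ … 𝔞 n x̄′ x̄` in ★ currency (the Lines file repackages by `exact`, cf. the HOME tail `frobCover₀_of_movedCover`).  `--supports stmt-HodgeConjecture-24832`,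
count-neutral.  HONEST LABEL: HC_CM is proved only modulo the cell's 2 remaining named inputs (hLiu418 24832, h413 24833) until rung 0 closes; this file discharges none.

## Mathematics (the route of A-p03 (g30)'s census v2 §3 rider, with the scalar bookkeeping of LA3-p02's Q-COV-λ)

`𝓨` a proper model at `v` (reduced, locally Noetherian), `𝒜 → 𝓨` commutative with `𝒪`-action `ι`, Serre data `(E′, P, Q, N)` presenting `𝔟 ≅ 𝔞⁻¹` (`𝔞 = (P_k)`,
`QP = N`, `PQ = N·E′`, `N ≠ 0`), `𝒞 := 𝒜 ⊗_𝒪 𝔟` with translation `ψ : 𝒜 → 𝒞` (kernel `𝒜[𝔞]`, fppf), the pull-back POLARISATION `λ^{pull}` of `𝒞` (`ψ ≫ λ^{pull} ≫ ψ^∨ = λ ≫ [N²]`,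
★ `serreTwistPolPull`), level structures `lvl`, `lvl′` with `lvl′.σ i = lvl.σ i ≫ ψ`, and integers `n, k` with `n·k = N²`.  UPSTAIRS at `x, x″` (characteristic `0`): a
surjective homomorphism `c : 𝒜_x → 𝒜_{x″}` with `Ker c(Ω̄) = 𝒜_x[𝔞](Ω̄)`, `c ≫ λ_{x″} ≫ c^∨ = λ_x ≫ [n]`, `ι_x(a) ≫ c = c ≫ ι_{x″}(a)`, `c(σ^a(x)) = σ^a(x″)`.
(1) RECOGNITION (★ `exists_iso_coverLeg_comp_eq_of_forall_points_of_charZero`): `E : 𝒞_x ≅ 𝒜_{x″}` with `ψ_x ≫ E = c`.  (2) LAWS OF `E`: `ι`-equivariance by cancelling the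
epimorphism `ψ_x`; level: `E(σ′^a(x)) = σ^a(x″)`; polarisation: `ψ_x ≫ (E ≫ (λ_{x″} ≫ [k]) ≫ E^∨) ≫ ψ_x^∨ = λ_x ≫ [nk] = λ_x ≫ [N²] = ψ_x ≫ λ^{pull}_x ≫ ψ_x^∨`, so by the
uniqueness of descent through `ψ_x`, `ψ_x^∨` (★ `comp_lam_comp_dualIsogenyOver_eq_of_pullback_eq`) `E ≫ (λ_{x″} ≫ [k]) ≫ E^∨ = λ^{pull}_x`, i.e. for the INVERSE
`E⁻¹ ≫ λ^{pull}_x ≫ (E⁻¹)^∨ = λ_{x″} ≫ [k]` — a law between POLARISATIONS of the two families, the shape ★ (ν8)(iv) transports.  (3) REDUCTION (★ (ν8d) on `E⁻¹`, families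
`𝒜`, `𝒞`, points `x″`, `x`): an isomorphism `ē : 𝒜_{x̄″} ≅ 𝒞_{x̄′}` with the three laws.  (4) The cover `u := ψ_{x̄′} ≫ ē⁻¹ : 𝒜_{x̄′} → 𝒜_{x̄″}` has kernel `𝒜_{x̄′}[𝔞]` on all
`T`-points and is surjective (★ `comp_coverLeg_eq_one_iff_forall_mem`, `surjective_coverLeg_left`, iso-invariance), is `ι`-equivariant, carries `σ^a(x̄′)` to `σ^a(x̄″)`, satisfies
`u ≫ λ_{x̄″} ≫ u^∨ = λ_{x̄′} ≫ [n]` (compose `ψ_{x̄′}`'s law for `λ^{pull}` (scalar `N² = nk`) with `ē⁻¹`'s exactness, then divide by `[k]`, ★ `comp_lam_comp_dualIsogenyOver_of_comp_mulN`),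
and has the Serre presentation (`u ≫ (ē ≫ d̄_a) = ι(a)`, `(ē ≫ d̄_a) ≫ u = ι″(a)` for `a ∈ 𝔞`, `d̄_a` from ★ `exists_serreTranslate_comp_eq_i_of_mem`).  (5) JUNCTION (★ (d3)
`exists_frobeniusTwist_cover_of_cover_of_presentation` along `x̄″ = x̄ ≫ F̃`): `c̄′ := u ≫ J : 𝒜_{x̄′} → (𝒜_{x̄})^{(q)}` with the five clauses against the twist.

## Contents (file II; file I = ★ `FrobeniusCoverRecognition`: `exists_coverRecognition`, `exists_cover_of_reducedRecognition`)
* **`exists_reducedRecognition`** — the reduced recognition isomorphism `ē : (𝒜_s)_{x̄″} ≅ (𝒞_s)_{x̄′}` with its three laws (file I §2 + ★ (ν8d)).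
* **`exists_frobCover_specialFibre`** — THE HEAD (+ file I §3 + ★ (d3) junction).

## References
* [Shimura1998] G. Shimura, *Abelian varieties with complex multiplication and modular functions* (1998), §13.1 Thm. 1 (pp. 97–99), §18.6 (pp. 127–128).
* [SerreTate1968] J.-P. Serre, J. Tate, *Good reduction of abelian varieties*, Ann. of Math. 88 (1968), §1 (Lemma 2, Thm. 1).
* [MumfordAV1970] D. Mumford, *Abelian Varieties* (1970), §7 Thm. 4 (p. 72), §15 Thm. 1 (p. 143), §23 Thm. 2 (p. 231).
* [RapoportSmithlingZhang2020Diagonal] M. Rapoport, B. Smithling, W. Zhang (2020), §3.2 (p. 11), §4.3 (4.23) (p. 21).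
* [Conrad2004GrossZagier] B. Conrad, *Gross–Zagier revisited*, MSRI Publ. 49 (2004), §7 (Thm. 7.5).
* [MumfordFogartyKirwan1994] D. Mumford, J. Fogarty, F. Kirwan, *GIT*, 3rd ed. (1994), Ch. 6 §1 Cor. 6.8 (p. 118), Ch. 7 §2 Def. 7.1–7.2 (p. 129).
-/


set_option autoImplicit false

noncomputable section

set_option backward.isDefEq.respectTransparency false

open CategoryTheory CategoryTheory.Limits AlgebraicGeometry MonoidalCategory CartesianMonoidalCategory
open scoped MonObj CategoryTheory.Obj NumberField
open Literature.AlgebraicGeometry.Motives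
open IsDedekindDomain IsDedekindDomain.HeightOneSpectrum ValuativeRel
open Literature.NumberTheory.EllipticCurves (genericFibre specGenericPoint)
open Literature.NumberTheory.GaloisRepresentations (closureValuationSubring)
open Literature.NumberTheory.DiophantineGeometry

namespace Literature.AlgebraicGeometry.AbelianSchemes

namespace AbelianSchemeOver

universe u

/-! ## The reduced recognition isomorphism and the head -/

section Head

variable {K : Type} [Field K] [NumberField K] {v : HeightOneSpectrum (𝓞 K)} {Y : SchemeOver K}
  (𝓨 : IntegralModel (valuationSubringAtPrime K v) K Y) [IsProper 𝓨.total.hom] [IsReduced 𝓨.total.left] [IsLocallyNoetherian 𝓨.total.left]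
  {𝒜 : AbelianSchemeOver 𝓨.total.left} {O : Type*} [CommRing O] (act : 𝒜.RingAction O) [IsCommMonObj 𝒜.X]
  {m : ℕ} (E' : Matrix (Fin m) (Fin m) O) (hE' : E' * E' = E') (P : Matrix (Fin m) (Fin 1) O) (Q : Matrix (Fin 1) (Fin m) O) {N : ℕ}
  (x x'' : AlgPoints Y (AlgebraicClosure (v.adicCompletion K)))
  (D : 𝒜.DualPair) (Db : (serreTensor act E' hE').DualPair)
  (hD : Nonempty ((Scheme.Modules.pullback (DualPair.unitHatSlice D)).obj D.P ≅ SheafOfModules.unit _))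
  (hDb : Nonempty ((Scheme.Modules.pullback (DualPair.unitHatSlice Db)).obj Db.P ≅ SheafOfModules.unit _))
  (pol : 𝒜.Polarization D)

include hD hDb in
set_option maxHeartbeats 400000 in
/-- **THE REDUCED RECOGNITION ISOMORPHISM `ē : (𝒜_s)_{x̄″} ≅ (𝒞_s)_{x̄′}` AND ITS THREE LAWS** (steps (1)–(3) of the module docstring: §2 upstairs, then ★ (ν8d)
`exists_specialFibre_iso_reduction` on `E⁻¹`): (λ) `ē ≫ λ^{pull}_{x̄′} ≫ ē^∨ = λ_{x̄″} ≫ [k]`, (ι) `ι_{x̄″}(a) ≫ ē = ē ≫ ι^𝒞_{x̄′}(a)`, (η) `ē(σ^a(x̄″)) = σ′^a(x̄′)`.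
[cite: SerreTate1968, §1 Lemma 2, Thm 1] [cite: BoschLutkebohmertRaynaud1990, §1.2 Prop. 8 and §7.3 Prop. 6 (p. 180)] [cite: MumfordAV1970, §15 Thm. 1 (p. 143), §23 Thm. 2 (p. 231)] -/
theorem exists_reducedRecognition
    (hN : N ≠ 0) (hP : E' * P = P) (hQ : Q * E' = Q)
    (hQP : Q * P = Matrix.scalar (Fin 1) (N : O)) (hPQ : P * Q = Matrix.scalar (Fin m) (N : O) * E')
    {𝔞 : Ideal O} (h𝔞 : Ideal.span (Set.range fun k => P k 0) = 𝔞) {n k : ℕ} (hk : n * k = N ^ 2)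
    -- the twisted level structure (★ `SerreTwistLevel`)
    {g₀ nlev : ℕ} (lvl : 𝒜.LevelStructure g₀ nlev) (lvl' : (serreTensor act E' hE').LevelStructure g₀ nlev)
    (hlvl : ∀ i, lvl'.σ i = lvl.σ i ≫ serreTranslate act E' hE' P)
    -- the upstairs cover between the fibres of `𝒜` at `x`, `x″`
    (c : ((𝒜.baseChange (𝓨.genericIso'.inv.left ≫ pullback.fst 𝓨.total.hom (specGenericPoint (valuationSubringAtPrime K v) K))).baseChange x.left).X ⟶
         ((𝒜.baseChange (𝓨.genericIso'.inv.left ≫ pullback.fst 𝓨.total.hom (specGenericPoint (valuationSubringAtPrime K v) K))).baseChange x''.left).X)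
    [IsMonHom c] [Surjective c.left]
    -- (t1′) the kernel of `c` on `Ω̄`-points is the `𝔞`-torsion
    (hker : ∀ Pt : ((𝒜.baseChange (𝓨.genericIso'.inv.left ≫ pullback.fst 𝓨.total.hom (specGenericPoint (valuationSubringAtPrime K v) K))).baseChange
        x.left).toAffine.toAbelianVariety.Points (AlgebraicClosure (v.adicCompletion K)),
      (AlgPoints.map c Pt : ((𝒜.baseChange (𝓨.genericIso'.inv.left ≫ pullback.fst 𝓨.total.hom (specGenericPoint (valuationSubringAtPrime K v) K))).baseChange
          x''.left).toAffine.toAbelianVariety.Points (AlgebraicClosure (v.adicCompletion K))) = 1 ↔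
        ∀ a ∈ 𝔞, (AlgPoints.map (((act.baseChange (𝓨.genericIso'.inv.left ≫ pullback.fst 𝓨.total.hom
            (specGenericPoint (valuationSubringAtPrime K v) K))).baseChange x.left).i a) Pt :
          ((𝒜.baseChange (𝓨.genericIso'.inv.left ≫ pullback.fst 𝓨.total.hom (specGenericPoint (valuationSubringAtPrime K v) K))).baseChange
            x.left).toAffine.toAbelianVariety.Points (AlgebraicClosure (v.adicCompletion K))) = 1)
    -- (t3) the polarisation law with scalar `n`
    (hc3 : c ≫ ((pol.baseChange (𝓨.genericIso'.inv.left ≫ pullback.fst 𝓨.total.hom (specGenericPoint (valuationSubringAtPrime K v) K))).baseChange x''.left).lam ≫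
        DualPair.dualIsogenyOver c
          ((D.baseChange (𝓨.genericIso'.inv.left ≫ pullback.fst 𝓨.total.hom (specGenericPoint (valuationSubringAtPrime K v) K))).baseChange x.left)
          ((D.baseChange (𝓨.genericIso'.inv.left ≫ pullback.fst 𝓨.total.hom (specGenericPoint (valuationSubringAtPrime K v) K))).baseChange x''.left) =
      ((pol.baseChange (𝓨.genericIso'.inv.left ≫ pullback.fst 𝓨.total.hom (specGenericPoint (valuationSubringAtPrime K v) K))).baseChange x.left).lam ≫
        ((D.baseChange (𝓨.genericIso'.inv.left ≫ pullback.fst 𝓨.total.hom (specGenericPoint (valuationSubringAtPrime K v) K))).baseChange x.left).hat.mulN n)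
    -- (t4) `ι`-equivariance
    (hc4 : ∀ a : O,
      ((act.baseChange (𝓨.genericIso'.inv.left ≫ pullback.fst 𝓨.total.hom (specGenericPoint (valuationSubringAtPrime K v) K))).baseChange x.left).i a ≫ c =
        c ≫ ((act.baseChange (𝓨.genericIso'.inv.left ≫ pullback.fst 𝓨.total.hom (specGenericPoint (valuationSubringAtPrime K v) K))).baseChange x''.left).i a)
    -- (t5) level points at `x` go to level points at `x″`
    (hc5 : ∀ a : Fin g₀ ⊕ Fin g₀ → ZMod nlev,
      AlgPoints.map c ((𝒜.baseChange (𝓨.genericIso'.inv.left ≫ pullback.fst 𝓨.total.hom (specGenericPoint (valuationSubringAtPrime K v) K))).restrictPt x.left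
          ((lvl.baseChange (𝓨.genericIso'.inv.left ≫ pullback.fst 𝓨.total.hom (specGenericPoint (valuationSubringAtPrime K v) K))).section_ a)) =
        (𝒜.baseChange (𝓨.genericIso'.inv.left ≫ pullback.fst 𝓨.total.hom (specGenericPoint (valuationSubringAtPrime K v) K))).restrictPt x''.left
          ((lvl.baseChange (𝓨.genericIso'.inv.left ≫ pullback.fst 𝓨.total.hom (specGenericPoint (valuationSubringAtPrime K v) K))).section_ a)) :
    ∃ (eb : ((𝒜.baseChange (pullback.fst 𝓨.total.hom (specResidueField v))).baseChange (𝓨.geomReductionMap x'').left).X ≅ (((serreTensor act E' hE').baseChange (pullback.fst 𝓨.total.hom (specResidueField v))).baseChange (𝓨.geomReductionMap x).left).X) (_ : IsMonHom eb.hom),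
      eb.hom ≫ ((((serreTwistPolPull act E' hE' P Q D Db hD hDb pol hN hP hQ hQP hPQ)).baseChange (pullback.fst 𝓨.total.hom (specResidueField v))).baseChange (𝓨.geomReductionMap x).left).lam ≫
          DualPair.dualIsogenyOver eb.hom ((D.baseChange (pullback.fst 𝓨.total.hom (specResidueField v))).baseChange (𝓨.geomReductionMap x'').left) ((Db.baseChange (pullback.fst 𝓨.total.hom (specResidueField v))).baseChange (𝓨.geomReductionMap x).left) =
        ((pol.baseChange (pullback.fst 𝓨.total.hom (specResidueField v))).baseChange (𝓨.geomReductionMap x'').left).lam ≫ ((D.baseChange (pullback.fst 𝓨.total.hom (specResidueField v))).baseChange (𝓨.geomReductionMap x'').left).hat.mulN k ∧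
      (∀ a : O, ((act.baseChange (pullback.fst 𝓨.total.hom (specResidueField v))).baseChange (𝓨.geomReductionMap x'').left).i a ≫ eb.hom = eb.hom ≫ (((serreAction act E' hE').baseChange (pullback.fst 𝓨.total.hom (specResidueField v))).baseChange (𝓨.geomReductionMap x).left).i a) ∧
      (∀ a : Fin g₀ ⊕ Fin g₀ → ZMod nlev,
        AlgPoints.map eb.hom ((𝒜.baseChange (pullback.fst 𝓨.total.hom (specResidueField v))).restrictPt (𝓨.geomReductionMap x'').left ((lvl.baseChange (pullback.fst 𝓨.total.hom (specResidueField v))).section_ a)) =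
          ((serreTensor act E' hE').baseChange (pullback.fst 𝓨.total.hom (specResidueField v))).restrictPt (𝓨.geomReductionMap x).left ((lvl'.baseChange (pullback.fst 𝓨.total.hom (specResidueField v))).section_ a)) := by
  haveI := isMonHom_serreTranslate act E' hE' P
  haveI := pol.isMonHom
  haveI : CharZero (v.adicCompletion K) := charZero_of_injective_algebraMap (algebraMap K (v.adicCompletion K)).injective
  haveI : IsLocallyNoetherian (specOver K (AlgebraicClosure (v.adicCompletion K))).left :=
    inferInstanceAs (IsLocallyNoetherian (Spec (.of (AlgebraicClosure (v.adicCompletion K)))))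
  haveI : IsReduced (specOver K (AlgebraicClosure (v.adicCompletion K))).left :=
    inferInstanceAs (IsReduced (Spec (.of (AlgebraicClosure (v.adicCompletion K)))))
  haveI : IsLocallyNoetherian (specOver v.asIdeal.ResidueField (geomResidueField v)).left :=
    inferInstanceAs (IsLocallyNoetherian (Spec (.of (geomResidueField v))))
  haveI : IsReduced (specOver v.asIdeal.ResidueField (geomResidueField v)).left :=
    inferInstanceAs (IsReduced (Spec (.of (geomResidueField v))))
  -- STEP 1–2 (§2): the recognition isomorphism `E : 𝒞_x ≅ 𝒜_{x″}` upstairs and the three laws of `E⁻¹`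
  obtain ⟨E, hEmon, hEinv, hE, hEl, hEi, hEs⟩ := exists_coverRecognition (𝓨.genericIso'.inv.left ≫ pullback.fst 𝓨.total.hom (specGenericPoint (valuationSubringAtPrime K v) K)) x.left x''.left act E' hE' P Q D Db hD hDb pol
    hN hP hQ hQP hPQ h𝔞 hk lvl lvl' hlvl c hker hc3 hc4 hc5
  haveI := hEmon
  haveI := hEinv
  -- STEP 3 (★ (ν8d)): reduce the ISOMORPHISM `E⁻¹ : 𝒜_{x″} → 𝒞_x` to `ē : (𝒜_s)_{x̄″} ≅ (𝒞_s)_{x̄′}`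
  obtain ⟨ebar, hebmon, hebiso, hii, hiii, hiv⟩ := exists_specialFibre_iso_reduction 𝓨 𝒜 (serreTensor act E' hE') x'' x E.inv
  haveI := hebiso
  -- the `Over`-isomorphism `ē` underlying `ebar`
  obtain ⟨eb, rfl, -⟩ : ∃ e : ((𝒜.baseChange (pullback.fst 𝓨.total.hom (specResidueField v))).baseChange (𝓨.geomReductionMap x'').left).X ≅ (((serreTensor act E' hE').baseChange (pullback.fst 𝓨.total.hom (specResidueField v))).baseChange (𝓨.geomReductionMap x).left).X,
      e.hom = ebar ∧ e.inv = inv ebar := ⟨asIso ebar, rfl, rfl⟩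
  haveI := hebmon
  -- laws of `ē`
  have hebl := hiv D pol Db (serreTwistPolPull act E' hE' P Q D Db hD hDb pol hN hP hQ hQP hPQ) k hEl
  have hebi : ∀ a : O, ((act.baseChange (pullback.fst 𝓨.total.hom (specResidueField v))).baseChange (𝓨.geomReductionMap x'').left).i a ≫ eb.hom =
      eb.hom ≫ (((serreAction act E' hE').baseChange (pullback.fst 𝓨.total.hom (specResidueField v))).baseChange (𝓨.geomReductionMap x).left).i a := fun a => by
    haveI := act.isMonHom a
    haveI := (serreAction act E' hE').isMonHom a
    exact hii (act.i a) ((serreAction act E' hE').i a) (hEi a)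
  have hebs : ∀ a : Fin g₀ ⊕ Fin g₀ → ZMod nlev,
      AlgPoints.map eb.hom ((𝒜.baseChange (pullback.fst 𝓨.total.hom (specResidueField v))).restrictPt (𝓨.geomReductionMap x'').left ((lvl.baseChange (pullback.fst 𝓨.total.hom (specResidueField v))).section_ a)) =
        ((serreTensor act E' hE').baseChange (pullback.fst 𝓨.total.hom (specResidueField v))).restrictPt (𝓨.geomReductionMap x).left ((lvl'.baseChange (pullback.fst 𝓨.total.hom (specResidueField v))).section_ a) := fun a => by
    have hup := hEs a
    rw [LevelStructure.baseChange_section_, LevelStructure.baseChange_section_] at hup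
    have h := hiii (lvl.section_ a) (lvl'.section_ a) hup
    rw [← LevelStructure.baseChange_section_, ← LevelStructure.baseChange_section_] at h
    exact h
  exact ⟨eb, hebmon, hebl, hebi, hebs⟩

include hD hDb in
set_option maxHeartbeats 400000 in
/-- **THE FROBENIUS COVER OF THE SPECIAL FIBRE FROM THE GENERIC SERRE COVER.**  In the setting of the module docstring, from an UPSTAIRS surjective homomorphism
`c : 𝒜_x → 𝒜_{x″}` at `x, x″ ∈ Y(Ω̄)` with `Ker c(Ω̄) = 𝒜_x[𝔞](Ω̄)`, `c ≫ λ_{x″} ≫ c^∨ = λ_x ≫ [n]`, `ι_x(a) ≫ c = c ≫ ι_{x″}(a)` and `c(σ^a(x)) = σ^a(x″)`, and a special point `x̄` with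
`red x″ = x̄ ≫ F̃` (`F̃` the `#κ(v) = p^r`-Frobenius of the special fibre), THERE IS a homomorphism **`c̄′ : (𝒜 ×_𝓨 𝓨_s)_{x̄′} → ((𝒜 ×_𝓨 𝓨_s)_{x̄}) ×_{κ̄, Frob^r} κ̄`** (`x̄′ = red x`) with
(f1) the SERRE PRESENTATION of `𝔞` (`c̄′ ≫ d = ι_{x̄′}(a)`, `d ≫ c̄′ = ι_{x̄}(a) ×_{κ̄} Frob^r` for `a ∈ 𝔞`), (f1′) KERNEL `(𝒜_s)_{x̄′}[𝔞]` ON ALL `T`-POINTS and surjective, (f3)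
`c̄′ ≫ (λ_{x̄} ×_{κ̄} Frob^r) ≫ c̄′^∨ = λ_{x̄′} ≫ [n]`, (f4) `ι_{x̄′}(a) ≫ c̄′ = c̄′ ≫ (ι_{x̄}(a) ×_{κ̄} Frob^r)`, (f5) `c̄′(σ^a(x̄′)) = F_{𝒜_{x̄}/κ̄}(σ^a(x̄))` — the clauses of the P6a letter
`FrobCover₀ … 𝔞 n x̄′ x̄` in ★ currency (`(ι(a) ×_𝓨 𝓨_s) ×_{𝓨_s} x̄ = (act₀Of … a x̄).hom.hom.hom`, `rfl`). [cite: Shimura1998, §13.1 Thm. 1 (pp. 97–99); §18.6 proof of Thm. 18.6 (pp. 127–128)]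
[cite: SerreTate1968, §1 Lemma 2, Thm 1] [cite: MumfordAV1970, §7 Thm. 4 (p. 72), §15 Thm. 1 (p. 143), §23 Thm. 2 (p. 231)] [cite: RapoportSmithlingZhang2020Diagonal, §4.3 (4.23) (p. 21)] -/
theorem exists_frobCover_specialFibre
    (hN : N ≠ 0) (hP : E' * P = P) (hQ : Q * E' = Q)
    (hQP : Q * P = Matrix.scalar (Fin 1) (N : O)) (hPQ : P * Q = Matrix.scalar (Fin m) (N : O) * E')
    {𝔞 : Ideal O} (h𝔞 : Ideal.span (Set.range fun k => P k 0) = 𝔞) {n k : ℕ} (hk : n * k = N ^ 2)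
    -- the twisted level structure (★ `SerreTwistLevel`)
    {g₀ nlev : ℕ} (lvl : 𝒜.LevelStructure g₀ nlev) (lvl' : (serreTensor act E' hE').LevelStructure g₀ nlev)
    (hlvl : ∀ i, lvl'.σ i = lvl.σ i ≫ serreTranslate act E' hE' P)
    -- Frobenius data downstairs
    (p r : ℕ) [ExpChar (geomResidueField v) p] (hq : Nat.card v.asIdeal.ResidueField = p ^ r)
    (xbar : AlgPoints 𝓨.reductionAt (geomResidueField v)) (hx'' : 𝓨.geomReductionMap x'' = xbar ≫ frobeniusOver 𝓨.reductionAt)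
    -- the upstairs cover between the fibres of `𝒜` at `x`, `x″`
    (c : ((𝒜.baseChange (𝓨.genericIso'.inv.left ≫ pullback.fst 𝓨.total.hom (specGenericPoint (valuationSubringAtPrime K v) K))).baseChange x.left).X ⟶
         ((𝒜.baseChange (𝓨.genericIso'.inv.left ≫ pullback.fst 𝓨.total.hom (specGenericPoint (valuationSubringAtPrime K v) K))).baseChange x''.left).X)
    [IsMonHom c] [Surjective c.left]
    -- (t1′) the kernel of `c` on `Ω̄`-points is the `𝔞`-torsion
    (hker : ∀ Pt : ((𝒜.baseChange (𝓨.genericIso'.inv.left ≫ pullback.fst 𝓨.total.hom (specGenericPoint (valuationSubringAtPrime K v) K))).baseChange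
        x.left).toAffine.toAbelianVariety.Points (AlgebraicClosure (v.adicCompletion K)),
      (AlgPoints.map c Pt : ((𝒜.baseChange (𝓨.genericIso'.inv.left ≫ pullback.fst 𝓨.total.hom (specGenericPoint (valuationSubringAtPrime K v) K))).baseChange
          x''.left).toAffine.toAbelianVariety.Points (AlgebraicClosure (v.adicCompletion K))) = 1 ↔
        ∀ a ∈ 𝔞, (AlgPoints.map (((act.baseChange (𝓨.genericIso'.inv.left ≫ pullback.fst 𝓨.total.hom
            (specGenericPoint (valuationSubringAtPrime K v) K))).baseChange x.left).i a) Pt :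
          ((𝒜.baseChange (𝓨.genericIso'.inv.left ≫ pullback.fst 𝓨.total.hom (specGenericPoint (valuationSubringAtPrime K v) K))).baseChange
            x.left).toAffine.toAbelianVariety.Points (AlgebraicClosure (v.adicCompletion K))) = 1)
    -- (t3) the polarisation law with scalar `n`
    (hc3 : c ≫ ((pol.baseChange (𝓨.genericIso'.inv.left ≫ pullback.fst 𝓨.total.hom (specGenericPoint (valuationSubringAtPrime K v) K))).baseChange x''.left).lam ≫
        DualPair.dualIsogenyOver c
          ((D.baseChange (𝓨.genericIso'.inv.left ≫ pullback.fst 𝓨.total.hom (specGenericPoint (valuationSubringAtPrime K v) K))).baseChange x.left)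
          ((D.baseChange (𝓨.genericIso'.inv.left ≫ pullback.fst 𝓨.total.hom (specGenericPoint (valuationSubringAtPrime K v) K))).baseChange x''.left) =
      ((pol.baseChange (𝓨.genericIso'.inv.left ≫ pullback.fst 𝓨.total.hom (specGenericPoint (valuationSubringAtPrime K v) K))).baseChange x.left).lam ≫
        ((D.baseChange (𝓨.genericIso'.inv.left ≫ pullback.fst 𝓨.total.hom (specGenericPoint (valuationSubringAtPrime K v) K))).baseChange x.left).hat.mulN n)
    -- (t4) `ι`-equivariance
    (hc4 : ∀ a : O,
      ((act.baseChange (𝓨.genericIso'.inv.left ≫ pullback.fst 𝓨.total.hom (specGenericPoint (valuationSubringAtPrime K v) K))).baseChange x.left).i a ≫ c =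
        c ≫ ((act.baseChange (𝓨.genericIso'.inv.left ≫ pullback.fst 𝓨.total.hom (specGenericPoint (valuationSubringAtPrime K v) K))).baseChange x''.left).i a)
    -- (t5) level points at `x` go to level points at `x″`
    (hc5 : ∀ a : Fin g₀ ⊕ Fin g₀ → ZMod nlev,
      AlgPoints.map c ((𝒜.baseChange (𝓨.genericIso'.inv.left ≫ pullback.fst 𝓨.total.hom (specGenericPoint (valuationSubringAtPrime K v) K))).restrictPt x.left
          ((lvl.baseChange (𝓨.genericIso'.inv.left ≫ pullback.fst 𝓨.total.hom (specGenericPoint (valuationSubringAtPrime K v) K))).section_ a)) =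
        (𝒜.baseChange (𝓨.genericIso'.inv.left ≫ pullback.fst 𝓨.total.hom (specGenericPoint (valuationSubringAtPrime K v) K))).restrictPt x''.left
          ((lvl.baseChange (𝓨.genericIso'.inv.left ≫ pullback.fst 𝓨.total.hom (specGenericPoint (valuationSubringAtPrime K v) K))).section_ a)) :
    ∃ (cbar : ((𝒜.baseChange (pullback.fst 𝓨.total.hom (specResidueField v))).baseChange (𝓨.geomReductionMap x).left).X ⟶
               (((𝒜.baseChange (pullback.fst 𝓨.total.hom (specResidueField v))).baseChange xbar.left).baseChange (frobSpec (geomResidueField v) p r)).X)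
      (_ : IsMonHom cbar),
      -- (f1) the Serre presentation of `𝔞`
      (∀ a ∈ 𝔞, ∃ d : (((𝒜.baseChange (pullback.fst 𝓨.total.hom (specResidueField v))).baseChange xbar.left).baseChange (frobSpec (geomResidueField v) p r)).X ⟶
            ((𝒜.baseChange (pullback.fst 𝓨.total.hom (specResidueField v))).baseChange (𝓨.geomReductionMap x).left).X,
        cbar ≫ d = baseChangeHom (baseChangeHom (act.i a) (pullback.fst 𝓨.total.hom (specResidueField v))) (𝓨.geomReductionMap x).left ∧
        d ≫ cbar = baseChangeHom (baseChangeHom (baseChangeHom (act.i a) (pullback.fst 𝓨.total.hom (specResidueField v))) xbar.left)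
          (frobSpec (geomResidueField v) p r)) ∧
      -- (f1′) the kernel is the `𝔞`-torsion on all `T`-points; surjective
      (∀ ⦃T : Over (Spec (.of (geomResidueField v)))⦄ (t : T ⟶ ((𝒜.baseChange (pullback.fst 𝓨.total.hom (specResidueField v))).baseChange (𝓨.geomReductionMap x).left).X),
        t ≫ cbar = 1 ↔ ∀ a ∈ 𝔞, t ≫ baseChangeHom (baseChangeHom (act.i a) (pullback.fst 𝓨.total.hom (specResidueField v))) (𝓨.geomReductionMap x).left = 1) ∧
      Function.Surjective cbar.left.base ∧
      -- (f3) `c̄′^*λ^{(q)} = n·λ`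
      cbar ≫ (((pol.baseChange (pullback.fst 𝓨.total.hom (specResidueField v))).baseChange xbar.left).baseChange (frobSpec (geomResidueField v) p r)).lam ≫
          DualPair.dualIsogenyOver cbar ((D.baseChange (pullback.fst 𝓨.total.hom (specResidueField v))).baseChange (𝓨.geomReductionMap x).left)
            (((D.baseChange (pullback.fst 𝓨.total.hom (specResidueField v))).baseChange xbar.left).baseChange (frobSpec (geomResidueField v) p r)) =
        ((pol.baseChange (pullback.fst 𝓨.total.hom (specResidueField v))).baseChange (𝓨.geomReductionMap x).left).lam ≫
          ((D.baseChange (pullback.fst 𝓨.total.hom (specResidueField v))).baseChange (𝓨.geomReductionMap x).left).hat.mulN n ∧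
      -- (f4) `ι`-equivariance against the twisted action
      (∀ a : O, baseChangeHom (baseChangeHom (act.i a) (pullback.fst 𝓨.total.hom (specResidueField v))) (𝓨.geomReductionMap x).left ≫ cbar =
        cbar ≫ baseChangeHom (baseChangeHom (baseChangeHom (act.i a) (pullback.fst 𝓨.total.hom (specResidueField v))) xbar.left) (frobSpec (geomResidueField v) p r)) ∧
      -- (f5) level points: `c̄′(σ^a(x̄′)) = F_{𝒜_{x̄}/κ̄}(σ^a(x̄))`
      (∀ a : Fin g₀ ⊕ Fin g₀ → ZMod nlev,
        AlgPoints.map cbar ((𝒜.baseChange (pullback.fst 𝓨.total.hom (specResidueField v))).restrictPt (𝓨.geomReductionMap x).left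
            ((lvl.baseChange (pullback.fst 𝓨.total.hom (specResidueField v))).section_ a)) =
          AlgPoints.map (relFrobeniusOver p r ((𝒜.baseChange (pullback.fst 𝓨.total.hom (specResidueField v))).baseChange xbar.left).X :
              ((𝒜.baseChange (pullback.fst 𝓨.total.hom (specResidueField v))).baseChange xbar.left).X ⟶
                (((𝒜.baseChange (pullback.fst 𝓨.total.hom (specResidueField v))).baseChange xbar.left).baseChange (frobSpec (geomResidueField v) p r)).X)
            ((𝒜.baseChange (pullback.fst 𝓨.total.hom (specResidueField v))).restrictPt xbar.left
              ((lvl.baseChange (pullback.fst 𝓨.total.hom (specResidueField v))).section_ a))) := by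
  obtain ⟨eb, hebmon, hebl, hebi, hebs⟩ := exists_reducedRecognition 𝓨 act E' hE' P Q x x'' D Db hD hDb pol hN hP hQ hQP hPQ h𝔞 hk lvl lvl' hlvl
    c hker hc3 hc4 hc5
  haveI := hebmon
  haveI : IsLocallyNoetherian (specOver v.asIdeal.ResidueField (geomResidueField v)).left :=
    inferInstanceAs (IsLocallyNoetherian (Spec (.of (geomResidueField v))))
  haveI : IsReduced (specOver v.asIdeal.ResidueField (geomResidueField v)).left :=
    inferInstanceAs (IsReduced (Spec (.of (geomResidueField v))))
  -- STEP 4 (§3): the cover `u := ψ_s ≫ ē⁻¹ : (𝒜_s)_{x̄′} → (𝒜_s)_{x̄″}` with its six clauses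
  obtain ⟨u, humon, hpres_u, hker_u, hsurj_u, hlam_u, hequiv_u, hsec_u⟩ :=
    exists_cover_of_reducedRecognition (pullback.fst 𝓨.total.hom (specResidueField v)) (𝓨.geomReductionMap x).left (𝓨.geomReductionMap x'').left act E' hE' P Q D Db hD hDb pol hN hP hQ hQP hPQ h𝔞 hk lvl lvl' hlvl
      eb hebl hebi hebs
  haveI := humon
  -- the letters' currency `(ι(a) ×_𝓨 𝓨_s) ×_{𝓨_s} x̄` for the base-changed action
  simp only [RingAction.baseChange_baseChange_i] at hpres_u hker_u hequiv_u
  -- STEP 5 (★ (d3) junction `J : (𝒜_s)_{x̄″} ≅ ((𝒜_s)_{x̄})^{(q)}` along `x̄″ = x̄ ≫ F̃`, and the transfer of the six clauses to `c̄′ := u ≫ J`)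
  obtain ⟨J, hJ, hJlam, hJnat, hJsec⟩ := (𝒜.baseChange (pullback.fst 𝓨.total.hom (specResidueField v))).exists_frobeniusTwist_junction p r hq xbar hx''
  haveI := hJ
  have hmon : ∀ a : O, IsMonHom (baseChangeHom (act.i a) (pullback.fst 𝓨.total.hom (specResidueField v))) := fun a => by
    haveI := act.isMonHom a
    exact isMonHom_baseChangeHom _ _
  refine ⟨u ≫ J.hom, inferInstance, fun a ha => ?_, fun T t => ?_, ?_, ?_, fun a => ?_, fun a => ?_⟩
  · -- (f1): `d′ := J⁻¹ ≫ d`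
    obtain ⟨d, hud, hdu⟩ := hpres_u a ha
    haveI := hmon a
    refine ⟨J.inv ≫ d, ?_, ?_⟩
    · rw [Category.assoc, J.hom_inv_id_assoc, hud]
    · rw [Category.assoc, ← Category.assoc d, hdu, hJnat (baseChangeHom (act.i a) (pullback.fst 𝓨.total.hom (specResidueField v))), J.inv_hom_id_assoc]
  · -- (f1′)
    exact comp_kernel_iff_of_mono u J.hom (fun _ t => ∀ a ∈ 𝔞, t ≫ baseChangeHom (baseChangeHom (act.i a) (pullback.fst 𝓨.total.hom (specResidueField v))) (𝓨.geomReductionMap x).left = 1) hker_u t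
  · -- surjectivity
    have h2 : Function.Surjective J.hom.left.base := (Scheme.homeoOfIso ((Over.forget _).mapIso J)).surjective
    rw [Over.comp_left, Scheme.Hom.comp_base, TopCat.coe_comp]
    exact h2.comp hsurj_u
  · -- (f3)
    exact comp_lam_comp_dualIsogenyOver_comp_of_exact ((D.baseChange (pullback.fst 𝓨.total.hom (specResidueField v))).baseChange (𝓨.geomReductionMap x).left) ((D.baseChange (pullback.fst 𝓨.total.hom (specResidueField v))).baseChange (𝓨.geomReductionMap x'').left)
      (((D.baseChange (pullback.fst 𝓨.total.hom (specResidueField v))).baseChange xbar.left).baseChange (frobSpec (geomResidueField v) p r)) ((pol.baseChange (pullback.fst 𝓨.total.hom (specResidueField v))).baseChange (𝓨.geomReductionMap x).left).lam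
      ((pol.baseChange (pullback.fst 𝓨.total.hom (specResidueField v))).baseChange (𝓨.geomReductionMap x'').left).lam (((pol.baseChange (pullback.fst 𝓨.total.hom (specResidueField v))).baseChange xbar.left).baseChange (frobSpec (geomResidueField v) p r)).lam
      u J.hom n hlam_u (hJlam (D.baseChange (pullback.fst 𝓨.total.hom (specResidueField v))) (pol.baseChange (pullback.fst 𝓨.total.hom (specResidueField v))))
  · -- (f4)
    haveI := hmon a
    rw [← Category.assoc, hequiv_u a, Category.assoc, hJnat (baseChangeHom (act.i a) (pullback.fst 𝓨.total.hom (specResidueField v))), Category.assoc]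
  · -- (f5)
    rw [AlgPoints.map_comp_apply, hsec_u a, hJsec ((lvl.baseChange (pullback.fst 𝓨.total.hom (specResidueField v))).section_ a)]

end Head

end AbelianSchemeOver

end Literature.AlgebraicGeometry.AbelianSchemes

end
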